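import Mathlib
import Literature.Analysis.Complex.HarmonicSchwarzReflection
import Summits.CriticalPhenomena.SAWScalingLimit.Theorems.SAWSpinMonotoneQCIdentificationDefs

/-!
# Stub `stub_rayRigidity` of line `eight_fifths_primitive` (crux `QCIdentification`, stmt-CriticalPhenomena-16772)

`RayRigidity` (vocabulary module `SAWSpinMonotoneQCIdentificationDefs`): for admissible data
`(D, ρ, Λ, m, a, b, Φ, L, L_b)`, every ray solution `g` of the spin-`5/8` Smirnov boundary problem on
`Ω = D.carrier` is a constant multiple of `e^{(5/8)(L - L_b)} = (Φ′/Φ′(b))^{5/8}`.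

Proof (pure complex analysis, the "Liouville end" of the line).
1. `Q w := e^{-iθ} G(Φ⁻¹ w) - iκ` is holomorphic on `ℍ` with `Im Q → 0` at every real point (the ray
   boundary values of `G`); the reflection principle
   (`Literature.Analysis.Complex.exists_differentiableOn_extension_of_tendsto_im` with `U = ℂ`) extends
   `Q` to an entire `F` with `F(w̄) = conj F(w)`.
2. The growth `‖G‖ ≤ C(1 + ‖Φ‖)` gives `‖F w‖ ≤ C′(1 + ‖w‖)` on `ℂ`; Cauchy's estimate on the circles
   of radius `1 + ‖c‖` bounds `F′`, Liouville makes `F′` constant, so `F w = α w + β`.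
3. Back on `Ω`: `G = e^{iθ}(αΦ + β + iκ)`, hence `e^{(8/5)ℓ} = G′ = αe^{iθ}Φ′ = αe^{iθ}e^{L}`, so
   `(8/5)ℓ - L - μ` (`e^{μ} = αe^{iθ}`) is continuous on the connected `Ω` with values in the discrete
   set `2πiℤ`, hence constant, and `g = e^{ℓ} = c · e^{(5/8)(L - L_b)}`.

Sources: H. Duminil-Copin, S. Smirnov, Ann. of Math. 175 (2012), Lemma 1 / Conjecture 2 (the boundary
value problem); L. V. Ahlfors, *Complex Analysis* (1979), Ch. 4 §6.5 Thm. 26 (reflection), Ch. 4 §2.3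
(Cauchy estimate, Liouville).
-/

noncomputable section

open Set Filter Topology Complex
open scoped ComplexConjugate
open Literature.Probability.RandomPlanarGeometry
open UpperHalfPlane (upperHalfPlaneSet)

namespace Summit.CriticalPhenomena.SAWScalingLimit.Cruxes.QCIdentification.EightFifthsPrimitive

/-- **Linear-growth Liouville.** An entire function with `‖F w‖ ≤ C (1 + ‖w‖)` is affine: Cauchy's
estimate on the circle of radius `1 + ‖c‖` about `c` gives `‖F′ c‖ ≤ 2 max C 0`, Liouville makes `F′`
constant, and a function with vanishing derivative is constant. [folklore] -/
theorem exists_affine_of_norm_le_linear {F : ℂ → ℂ} (hF : Differentiable ℂ F) {C : ℝ}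
    (hC : ∀ w, ‖F w‖ ≤ C * (1 + ‖w‖)) : ∃ α β : ℂ, ∀ w, F w = α * w + β := by
  have hbd : ∀ c, ‖deriv F c‖ ≤ 2 * max C 0 := by
    intro c
    have hR : 0 < 1 + ‖c‖ := by positivity
    have key := Complex.norm_deriv_le_of_forall_mem_sphere_norm_le (c := c)
      (C := 2 * max C 0 * (1 + ‖c‖)) hR hF.diffContOnCl (fun z hz ↦ ?_)
    · rwa [mul_div_assoc, div_self hR.ne', mul_one] at key
    · rw [Metric.mem_sphere, dist_eq_norm] at hz
      have hz' : ‖z‖ ≤ 1 + 2 * ‖c‖ :=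
        calc ‖z‖ = ‖(z - c) + c‖ := by rw [sub_add_cancel]
          _ ≤ ‖z - c‖ + ‖c‖ := norm_add_le _ _
          _ = 1 + 2 * ‖c‖ := by rw [hz]; ring
      calc ‖F z‖ ≤ C * (1 + ‖z‖) := hC z
        _ ≤ max C 0 * (1 + ‖z‖) := mul_le_mul_of_nonneg_right (le_max_left _ _) (by positivity)
        _ ≤ max C 0 * (2 * (1 + ‖c‖)) := mul_le_mul_of_nonneg_left (by linarith) (le_max_right _ _)
        _ = 2 * max C 0 * (1 + ‖c‖) := by ring
  have hconst : ∀ c, deriv F c = deriv F 0 := fun c ↦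
    hF.deriv.apply_eq_apply_of_bounded
      (isBounded_iff_forall_norm_le.2 ⟨2 * max C 0, by rintro _ ⟨c, rfl⟩; exact hbd c⟩) c 0
  refine ⟨deriv F 0, F 0, fun w ↦ ?_⟩
  have hdiff : Differentiable ℂ (fun w ↦ F w - deriv F 0 * w) :=
    hF.sub (differentiable_const _ |>.mul differentiable_id)
  have hd : ∀ x, deriv (fun w ↦ F w - deriv F 0 * w) x = 0 := by
    intro x
    have h1 : HasDerivAt (fun w ↦ deriv F 0 * w) (deriv F 0 * 1) x :=
      (hasDerivAt_id' x).const_mul (deriv F 0)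
    have h2 := ((hF x).hasDerivAt.fun_sub h1).deriv
    rw [h2, hconst x, mul_one, sub_self]
  have := is_const_of_deriv_eq_zero hdiff hd w 0
  simp only [mul_zero, sub_zero] at this
  linear_combination this

/-- **Growth transfer by reflection.** If `F` is continuous on `ℂ`, equals `Q` on the open upper
half-plane and satisfies `F(w̄) = conj F(w)`, then a linear bound `‖Q w‖ ≤ C (1 + ‖w‖)` on `ℍ` holds for
`F` on all of `ℂ` (closure for `im w = 0`, symmetry for `im w < 0`). [folklore] -/
theorem norm_le_linear_of_conj_symm {F Q : ℂ → ℂ} (hFc : Continuous F)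
    (hFQ : EqOn F Q {z : ℂ | 0 < z.im}) (hsymm : ∀ z ∈ (univ : Set ℂ), F (conj z) = conj (F z))
    {C : ℝ} (hQ : ∀ w ∈ {z : ℂ | 0 < z.im}, ‖Q w‖ ≤ C * (1 + ‖w‖)) (w : ℂ) :
    ‖F w‖ ≤ C * (1 + ‖w‖) := by
  have hup : ∀ w : ℂ, 0 ≤ w.im → ‖F w‖ ≤ C * (1 + ‖w‖) := by
    intro w hw
    have hcl : w ∈ closure {z : ℂ | 0 < z.im} := by
      rw [Complex.closure_setOf_lt_im]; exact hw
    refine le_on_closure (f := fun w ↦ ‖F w‖) (g := fun w ↦ C * (1 + ‖w‖)) (fun z hz ↦ ?_) ?_ ?_ hcl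
    · show ‖F z‖ ≤ C * (1 + ‖z‖)
      rw [hFQ hz]; exact hQ z hz
    · exact (continuous_norm.comp hFc).continuousOn
    · exact (continuous_const.mul (continuous_const.add continuous_norm)).continuousOn
  rcases le_or_gt 0 w.im with hw | hw
  · exact hup w hw
  · have h1 : F w = conj (F (conj w)) := by
      have := hsymm (conj w) (mem_univ _)
      rwa [Complex.conj_conj] at this
    have h2 : 0 ≤ (conj w).im := by rw [Complex.conj_im]; linarith
    have h3 := hup (conj w) h2
    rw [Complex.norm_conj] at h3
    rw [h1, Complex.norm_conj]
    exact h3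

/-- **Ray rigidity** (`stub_rayRigidity` of line `eight_fifths_primitive`): for admissible data every
`RaySolution g` on `Ω = D.carrier` is `c · e^{(5/8)(L - L_b)}`. Reflection of
`Q = e^{-iθ}G∘Φ⁻¹ - iκ` across `ℝ`, linear-growth Liouville (`Q = αw + β`), then
`e^{(8/5)ℓ} = αe^{iθ}e^{L}` on the connected `Ω` forces `(8/5)ℓ - L` to be constant modulo the discrete
`2πiℤ`. [folklore] -/
theorem stub_rayRigidity : RayRigidity := by
  intro D ρ Λ m a b Φ L Lb hadm g hg
  obtain ⟨-, -, -, -, -, -, -, -, hL, hexpL, -⟩ := hadm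
  obtain ⟨ℓ, G, θ, κ, C, hℓ, hℓg, hG, hG', hbdry, hgrowth⟩ := hg
  have hΩo : IsOpen D.carrier := D.isOpen
  -- (1) the function `Q` on `ℍ`
  obtain ⟨Q, hQdef⟩ : ∃ Q : ℂ → ℂ,
      Q = fun w ↦ Complex.exp (-(θ * I)) * G (Φ.symm w) - κ * I := ⟨_, rfl⟩
  have hQd : DifferentiableOn ℂ Q upperHalfPlaneSet := by
    rw [hQdef]
    exact ((hG.comp Φ.symm.differentiableOn_coe Φ.symm_mapsTo).const_mul _).sub_const _
  -- (2) boundary values: `im Q → 0` at every real point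
  have hQlim : ∀ x : ℂ, x.im = 0 →
      Tendsto (fun w ↦ (Q w).im) (𝓝[upperHalfPlaneSet] x) (𝓝 0) := by
    intro x hx
    rw [Metric.tendsto_nhdsWithin_nhds]
    intro ε hε
    obtain ⟨η, hη, hηQ⟩ := hbdry x.re ε hε
    refine ⟨η, hη, fun w hw hwx ↦ ?_⟩
    have hzΩ : Φ.symm w ∈ D.carrier := Φ.symm_mapsTo hw
    have hΦz : Φ (Φ.symm w) = w := Φ.apply_symm_apply hw
    have hxre : ((x.re : ℝ) : ℂ) = x := by
      apply Complex.ext <;> simp [hx]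
    have h1 : ‖Φ (Φ.symm w) - (x.re : ℂ)‖ < η := by
      rw [hΦz, hxre, ← dist_eq_norm]; exact hwx
    have h2 := hηQ (Φ.symm w) hzΩ h1
    have hQim : (Q w).im = (Complex.exp (-(θ * I)) * G (Φ.symm w)).im - κ := by
      rw [hQdef]; simp
    rw [Real.dist_eq, sub_zero, hQim]
    exact h2
  -- (3) reflection: `Q` extends to an entire, conjugation-symmetric `F`
  obtain ⟨F, hFd, hFQ, hFsymm, -⟩ :=
    Literature.Analysis.Complex.exists_differentiableOn_extension_of_tendsto_im
      (U := univ) (f := Q) isOpen_univ (fun z _ ↦ mem_univ _)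
      (by rw [univ_inter]; exact hQd)
      (by intro x _ hx; rw [univ_inter]; exact hQlim x hx)
  rw [univ_inter] at hFQ
  have hF : Differentiable ℂ F := differentiableOn_univ.1 hFd
  -- (4) linear growth of `Q` on `ℍ`, hence of `F` on `ℂ`
  have hQgrowth : ∀ w ∈ upperHalfPlaneSet, ‖Q w‖ ≤ (max C 0 + |κ|) * (1 + ‖w‖) := by
    intro w hw
    have hzΩ : Φ.symm w ∈ D.carrier := Φ.symm_mapsTo hw
    have hΦz : Φ (Φ.symm w) = w := Φ.apply_symm_apply hw
    have hexp1 : ‖Complex.exp (-(θ * I))‖ = 1 := by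
      rw [Complex.norm_exp]; simp
    have hG1 : ‖G (Φ.symm w)‖ ≤ C * (1 + ‖w‖) := by
      have := hgrowth _ hzΩ
      rwa [hΦz] at this
    have hw0 : (0 : ℝ) ≤ 1 + ‖w‖ := by positivity
    rw [hQdef]
    calc ‖Complex.exp (-(θ * I)) * G (Φ.symm w) - κ * I‖
        ≤ ‖Complex.exp (-(θ * I)) * G (Φ.symm w)‖ + ‖(κ : ℂ) * I‖ := norm_sub_le _ _
      _ = ‖G (Φ.symm w)‖ + |κ| := by
          rw [norm_mul, hexp1, one_mul, norm_mul, Complex.norm_I, mul_one, Complex.norm_real,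
            Real.norm_eq_abs]
      _ ≤ C * (1 + ‖w‖) + |κ| := by gcongr
      _ ≤ max C 0 * (1 + ‖w‖) + |κ| * (1 + ‖w‖) :=
          add_le_add (mul_le_mul_of_nonneg_right (le_max_left _ _) hw0)
            (le_mul_of_one_le_right (abs_nonneg κ) (by linarith [norm_nonneg w]))
      _ = (max C 0 + |κ|) * (1 + ‖w‖) := by ring
  have hFgrowth : ∀ w, ‖F w‖ ≤ (max C 0 + |κ|) * (1 + ‖w‖) :=
    norm_le_linear_of_conj_symm hF.continuous hFQ hFsymm hQgrowth
  -- (5)–(7) `F` is affine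
  obtain ⟨α, β, hαβ⟩ := exists_affine_of_norm_le_linear hF hFgrowth
  -- (8) identification on `Ω`: `G = e^{iθ} (α Φ + β + iκ)` and `e^{(8/5)ℓ} = e^{iθ} α e^{L}`
  have hGform : ∀ z ∈ D.carrier, G z = Complex.exp (θ * I) * (α * Φ z + (β + κ * I)) := by
    intro z hz
    have hw : Φ z ∈ upperHalfPlaneSet := Φ.mapsTo hz
    have h1 : F (Φ z) = Q (Φ z) := hFQ hw
    have h2 : Q (Φ z) = Complex.exp (-(θ * I)) * G z - κ * I := by
      rw [hQdef]; simp only [Φ.symm_apply_apply hz]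
    rw [hαβ, h2] at h1
    have h3 : Complex.exp (θ * I) * Complex.exp (-(θ * I)) = 1 := by
      rw [← Complex.exp_add, add_neg_cancel, Complex.exp_zero]
    linear_combination -(Complex.exp (θ * I)) * h1 - G z * h3
  have hkey : ∀ z ∈ D.carrier,
      Complex.exp ((8 / 5 : ℂ) * ℓ z) = Complex.exp (θ * I) * α * Complex.exp (L z) := by
    intro z hz
    have hΦd : HasDerivAt Φ (deriv Φ z) z :=
      (Φ.differentiableOn_coe.differentiableAt (hΩo.mem_nhds hz)).hasDerivAt
    have hR : HasDerivAt (fun y ↦ Complex.exp (θ * I) * (α * Φ y + (β + κ * I)))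
        (Complex.exp (θ * I) * (α * deriv Φ z)) z :=
      ((hΦd.const_mul α).add_const (β + κ * I)).const_mul (Complex.exp (θ * I))
    have hev : G =ᶠ[𝓝 z] fun y ↦ Complex.exp (θ * I) * (α * Φ y + (β + κ * I)) := by
      filter_upwards [hΩo.mem_nhds hz] with y hy
      exact hGform y hy
    rw [← hG' z hz, hev.deriv_eq, hR.deriv, ← hexpL z hz]
    ring
  -- (9) `(8/5)ℓ - L - μ ∈ 2πiℤ` is constant on the connected `Ω`
  by_cases hα : Complex.exp (θ * I) * α = 0
  · refine ⟨0, fun z hz ↦ ?_⟩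
    exact absurd (by rw [hkey z hz, hα, zero_mul]) (Complex.exp_ne_zero ((8 / 5 : ℂ) * ℓ z))
  obtain ⟨μ, hexpμ⟩ : ∃ μ : ℂ, Complex.exp μ = Complex.exp (θ * I) * α :=
    ⟨_, Complex.exp_log hα⟩
  obtain ⟨h, hhdef⟩ : ∃ h : ℂ → ℂ, h = fun z ↦ (8 / 5 : ℂ) * ℓ z - L z - μ := ⟨_, rfl⟩
  have hhc : ContinuousOn h D.carrier := by
    rw [hhdef]
    exact ((continuousOn_const.mul hℓ.continuousOn).sub hL).sub continuousOn_const
  have hhT : MapsTo h D.carrier (AddSubgroup.zmultiples (2 * Real.pi * I) : Set ℂ) := by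
    intro z hz
    have h1 : Complex.exp ((8 / 5 : ℂ) * ℓ z) = Complex.exp (L z + μ) := by
      rw [hkey z hz, Complex.exp_add, hexpμ]; ring
    obtain ⟨n, hn⟩ := Complex.exp_eq_exp_iff_exists_int.1 h1
    rw [SetLike.mem_coe, AddSubgroup.mem_zmultiples_iff]
    refine ⟨n, ?_⟩
    rw [zsmul_eq_mul, hhdef]
    linear_combination -hn
  have hdisc : IsDiscrete (AddSubgroup.zmultiples (2 * Real.pi * I) : Set ℂ) :=
    ⟨NormedSpace.discreteTopology_zmultiples _⟩
  obtain ⟨y, -, hy⟩ := D.isConnected.isPreconnected.eqOn_const_of_mapsTo hdisc hhc hhT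
    ⟨0, zero_mem _⟩
  -- (10) conclusion
  refine ⟨Complex.exp ((5 / 8 : ℂ) * (μ + y + Lb)), fun z hz ↦ ?_⟩
  have hz' : (8 / 5 : ℂ) * ℓ z - L z - μ = y := by
    have := hy hz
    rwa [hhdef] at this
  rw [← hℓg z hz, ← Complex.exp_add]
  congr 1
  linear_combination (5 / 8 : ℂ) * hz'

end Summit.CriticalPhenomena.SAWScalingLimit.Cruxes.QCIdentification.EightFifthsPrimitive
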